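import Summits.Ventures.YMGap.RobustBall.ThreePointDecayS
import HarnessLib

/-!
# Venture YMGap, track ROBUST-BALL (Y2) — TIER 2: ONE SUMMABLE MAJORANT FOR THE THIRD CUMULANTS OF A LOCAL OBSERVABLE AGAINST TWO DIRECTIONS,
# UNIFORMLY ON THE WEIGHTED BALL (bookkeeping for the second-order susceptibility and the `C^{1,1}` / `C²` statements)

HONEST FRAMING. WHAT THIS IS: a venture file (cell `pub-ymgap`, track Y2 ROBUST-BALL, seat rb-p1, theorems only), the summation of the tree decay
of the third cumulant (`ThreePointDecayS.abs_threePoint_le_tree_S`) over two directions `V`, `V'` of the ball.  Member `W ∈ MemBallZdS a Λ_t t` inside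
the one-link pair door `ρ := 6(d−1)|β| e^{a} e^{t} √(cv) + e^{a/2} √c Λ_t < 1` (`t ≥ 0`), ANY DLR state `μ`, local observable `F` (on `Λ_F`, vector `δ_F`,
bounded), directions `V`, `V'` with measurable bounded own-link terms and Frobenius-Lipschitz witnesses of total load `≤ L`, `≤ L'` and of
SIZE-WEIGHTED load `Σ'_{X∋e} #X·Σ_y lipV_X(y) ≤ L₂`, `≤ L₂'` through every link (finite-range or bounded-size directions have both):
* `threePoint_sub_const_right` — the third cumulant is invariant under constant shifts of an argument (centring);
* `brackets_le_four_trees` — `(q+r)(p+r)(p+q) ≤ 4(pq + pr + qr)` on `[0,1]³` (every monomial of the three-split product is a tree);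
* ★★ `sum_abs_threePoint_le_S` — for all finite families `T`, `T'` of link sets:
  `Σ_{X∈T} Σ_{Y∈T'} |u₃(F; V_X; V'_Y)| ≤ 768 N√N (Σδ_F) #Λ_F C_s (L L' #Λ_F C_s + L' L₂ C_s + L L₂' C_s)`, `C_s = d((1+e^{−s/d})/(1−e^{−s/d}))^d`, `s = t/3`
  — ONE constant for the ball (the summability over ALL pairs and the `SU(2)` cell are in `SecondSusceptibilitySeries.lean`): THE SECOND-ORDER
  RESPONSE COEFFICIENT `Σ_{X,Y} u₃(F; V_X; V'_Y)` (the would-be `d²/ds ds'` of `⟨F⟩_{W+sV+s'V'}`) IS FINITE, UNIFORMLY ON THE BALL.  Mechanism: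
  centre all three observables at the unit configuration (`M ↦ 2√N Σδ`), tree decay, each tree exponential dominated by link sums, and the load
  bookkeeping of `DirectionalSusceptibilityS` twice (the middle vertex of a path tree costs the size weight).
WHAT THIS IS NOT: the identification of the double series with a second derivative of the state (needs the Feynman–Hellmann formula for
covariances along truncated lines — successor file); one-sided Dobrushin-comparison constants at lattice strong coupling; nothing about the
continuum limit or a Clay-sense mass gap.
-/

noncomputable section

open MeasureTheory Function Finset ProbabilityTheory Real
open scoped NNReal
open Literature.Probability.LatticeModels
open Literature.Probability.LatticeModels.DobrushinMetric
open Literature.MathematicalPhysics.QuantumLattice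
open Literature.MathematicalPhysics.QuantumFieldTheory hiding ZdEdge
open Summit.QuantumFields.BalabanUV.InfraRed.StrongCouplingPoincareDoorSUN (oneLinkPoincareSUN_two_sharp)
open Summit.Ventures.YMGap.CouplingResponse (threePoint_swap threePoint_rotate)

namespace Summit.Ventures.YMGap.RobustBall

variable {d N : ℕ}

/-! ### Centring and the three-bracket inequality -/

/-- **The third cumulant is invariant under a constant shift of its last argument** (bounded measurable observables, probability measure). -/
theorem threePoint_sub_const_right {Ω : Type*} [MeasurableSpace Ω] {μ : Measure Ω} [IsProbabilityMeasure μ] {X Y Z : Ω → ℝ} {A B C : ℝ}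
    (hX : Measurable X) (hY : Measurable Y) (hZ : Measurable Z) (hA : ∀ ω, |X ω| ≤ A) (hB : ∀ ω, |Y ω| ≤ B) (hC : ∀ ω, |Z ω| ≤ C) (c : ℝ) :
    cov[fun ω => X ω * Y ω, fun ω => Z ω - c; μ] - (∫ ω, X ω ∂μ) * cov[Y, fun ω => Z ω - c; μ] -
        (∫ ω, Y ω ∂μ) * cov[X, fun ω => Z ω - c; μ] =
      cov[fun ω => X ω * Y ω, Z; μ] - (∫ ω, X ω ∂μ) * cov[Y, Z; μ] - (∫ ω, Y ω ∂μ) * cov[X, Z; μ] := by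
  have hZi : Integrable Z μ := (MemLp.of_bound hZ.aestronglyMeasurable C (Filter.Eventually.of_forall fun ω => by
    rw [Real.norm_eq_abs]; exact hC ω)).integrable one_le_two
  have _hX := hX; have _hY := hY; have _hA := hA; have _hB := hB
  rw [covariance_sub_const_right hZi, covariance_sub_const_right hZi, covariance_sub_const_right hZi]

/-- `(q + r)(p + r)(p + q) ≤ 4(pq + pr + qr)` for `p, q, r ∈ [0, 1]`: every monomial of the three-split product is dominated by a tree. -/
theorem brackets_le_four_trees {p q r : ℝ} (hp0 : 0 ≤ p) (hp1 : p ≤ 1) (hq0 : 0 ≤ q) (hq1 : q ≤ 1) (hr0 : 0 ≤ r) (hr1 : r ≤ 1) :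
    (q + r) * (p + r) * (p + q) ≤ 4 * (p * q + p * r + q * r) := by
  nlinarith [mul_nonneg hp0 hq0, mul_nonneg hp0 hr0, mul_nonneg hq0 hr0, mul_nonneg (mul_nonneg hp0 hq0) hr0,
    mul_le_mul_of_nonneg_left hp1 (mul_nonneg hp0 hq0), mul_le_mul_of_nonneg_left hq1 (mul_nonneg hp0 hq0),
    mul_le_mul_of_nonneg_left hr1 (mul_nonneg hp0 hq0), mul_le_mul_of_nonneg_left hq1 (mul_nonneg hq0 hr0),
    mul_le_mul_of_nonneg_left hr1 (mul_nonneg hq0 hr0), mul_le_mul_of_nonneg_left hp1 (mul_nonneg hp0 hr0),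
    mul_le_mul_of_nonneg_left hr1 (mul_nonneg hp0 hr0)]

/-! ### The majorant -/

section SUN

variable {W V V' : Potential (ZdEdge d) (Matrix.specialUnitaryGroup (Fin N) ℂ)}

/-- **Termwise majorant of the third cumulant against two directions (bookkeeping form).**  Member `W ∈ MemBallZdS a Λ_t t` in the pair door
(`t > 0`), ANY DLR `μ`; `F` local (on `Λ_F`, vector `δ_F`, bounded); directions `V`, `V'` with measurable bounded own-link terms and Frobenius-Lipschitz
witnesses `lipV`, `lipV'`.  With the abbreviations `s = t/3`, `S_f = Σδ_F`, `L_X = Σ_y lipV_X(y)`, `L'_Y`, `g_Δ(e) = e^{−s·dist(e,Δ)}` (passed as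
equations), for all `X`, `Y`: `|u₃(F; V_X; V'_Y)| ≤ 768 N√N S_f · L_X L'_Y · (G_F(X)G_F(Y) + G_F(X)G_X(Y) + G_F(Y)G_Y(X))`, `G_Δ(Z) = Σ_{e∈Z} g_Δ(e)`
— the tree bound of `ThreePointDecayS` after centring, with every tree exponential dominated by link sums; ONE majorant for every member of
the ball and every DLR state. -/
theorem abs_threePoint_le_majorant_S (hd : 1 ≤ d) (hN : 1 ≤ N) {β b c v a Λt t : ℝ}
    (hc : 0 ≤ c) (hv : 0 ≤ v) (hb : |β| * (2 * ((d : ℝ) - 1)) ≤ b)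
    (hP : ∀ B : Matrix (Fin N) (Fin N) ℂ, matrixOpNorm B ≤ b →
      ∀ (ψ : Matrix.specialUnitaryGroup (Fin N) ℂ → ℝ) (M : ℝ), 0 ≤ M →
        (∀ x y, |ψ x - ψ y| ≤ M * suFrobDist x y) →
        Var[ψ; (haarProbability (Matrix.specialUnitaryGroup (Fin N) ℂ)).tilted
          fun g => (N : ℝ) * ((g : Matrix (Fin N) (Fin N) ℂ) * B).trace.re] ≤ c * M ^ 2)
    (hVB : ∀ B : Matrix (Fin N) (Fin N) ℂ, matrixOpNorm B ≤ b → ∀ Δ : Matrix (Fin N) (Fin N) ℂ,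
      Var[fun g : Matrix.specialUnitaryGroup (Fin N) ℂ =>
          (N : ℝ) * ((g : Matrix (Fin N) (Fin N) ℂ) * Δ).trace.re;
        (haarProbability (Matrix.specialUnitaryGroup (Fin N) ℂ)).tilted
          fun g => (N : ℝ) * ((g : Matrix (Fin N) (Fin N) ℂ) * B).trace.re] ≤ v * frobNorm Δ ^ 2)
    (ht : 0 < t) (hρ : 6 * ((d : ℝ) - 1) * |β| * (exp a * exp t * Real.sqrt (c * v)) + exp (a / 2) * Real.sqrt c * Λt < 1)
    (hW : MemBallZdS a Λt t W) {μ : Measure (LGConfig d (Matrix.specialUnitaryGroup (Fin N) ℂ))}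
    (hμ : μ ∈ perturbedGibbsMeasuresS (d := d) (fundamentalRep (Fin N)) (N * β) W)
    {F : LGConfig d (Matrix.specialUnitaryGroup (Fin N) ℂ) → ℝ} (hFm : Measurable F) {ΛF : Finset (ZdEdge d)}
    (hFdep : DependsOn F (↑ΛF : Set (ZdEdge d))) {MF : ℝ} (hMF : ∀ σ, |F σ| ≤ MF) {δF : ZdEdge d → ℝ} (hδF : IsLipBound suFrobDist F δF)
    (hVm : ∀ X, Measurable (V X)) (hVdep : ∀ X, DependsOn (V X) (↑X : Set (ZdEdge d))) (hVb : ∀ X, ∃ C, ∀ U, |V X U| ≤ C)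
    {lipV : Finset (ZdEdge d) → ZdEdge d → ℝ} (hlipV : ∀ X, IsLipBound suFrobDist (V X) (lipV X))
    (hV'm : ∀ X, Measurable (V' X)) (hV'dep : ∀ X, DependsOn (V' X) (↑X : Set (ZdEdge d))) (hV'b : ∀ X, ∃ C, ∀ U, |V' X U| ≤ C)
    {lipV' : Finset (ZdEdge d) → ZdEdge d → ℝ} (hlipV' : ∀ X, IsLipBound suFrobDist (V' X) (lipV' X))
        {s : ℝ} (hs : s = t / 3) {Sf : ℝ} (hSf : Sf = ∑ y ∈ ΛF, δF y)
    {LX LY : Finset (ZdEdge d) → ℝ} (hLX : LX = fun X => ∑ y ∈ X, lipV X y) (hLY : LY = fun Y => ∑ y ∈ Y, lipV' Y y)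
    {gD : Finset (ZdEdge d) → ZdEdge d → ℝ} (hgD : gD = fun Δ e => exp (-s * linkSetDist Δ e)) (X Y : Finset (ZdEdge d)) :
    |cov[fun σ => F σ * V X σ, V' Y; μ] - (∫ σ, F σ ∂μ) * cov[V X, V' Y; μ] - (∫ σ, V X σ ∂μ) * cov[F, V' Y; μ]| ≤
      768 * N * Real.sqrt N * Sf * (LX X * LY Y * ((∑ e ∈ X, gD ΛF e) * (∑ e ∈ Y, gD ΛF e) +
        (∑ e ∈ X, gD ΛF e) * (∑ e ∈ Y, gD X e) + (∑ e ∈ Y, gD ΛF e) * (∑ e ∈ X, gD Y e))) := by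
  classical
  have hμP : IsGibbsMeasure (perturbedYMS (d := d) (fundamentalRep (Fin N)) (N * β) W) μ := hμ
  haveI := hμP.isProbabilityMeasure
  have hSf0 : 0 ≤ Sf := hSf ▸ sum_nonneg fun y _ => hδF.nonneg y
  have hLX0 : ∀ X, 0 ≤ LX X := fun X => by rw [hLX]; exact sum_nonneg fun y _ => (hlipV X).nonneg y
  have hLY0 : ∀ Y, 0 ≤ LY Y := fun Y => by rw [hLY]; exact sum_nonneg fun y _ => (hlipV' Y).nonneg y
  have hgD0 : ∀ Δ e, 0 ≤ gD Δ e := fun Δ e => by rw [hgD]; exact (exp_pos _).le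
  have hd0 : 0 < d := hd
  have hNN : (0 : ℝ) ≤ N := Nat.cast_nonneg N

  have hs0 : 0 < s := by rw [hs]; positivity
  -- conversion of a set distance into a link sum
  have hconv : ∀ {A X : Finset (ZdEdge d)}, A.Nonempty → X.Nonempty → exp (-(s * setDistEdges A X)) ≤ ∑ e ∈ X, gD A e := by
    intro A X hA hX
    obtain ⟨u, hu, w, hw, heq⟩ := exists_setDistEdges_eq hA hX
    have h1 : linkSetDist A w ≤ ‖u.1 - w.1‖ := by
      unfold linkSetDist; rw [dif_pos hA, norm_sub_rev]; exact Finset.inf'_le _ hu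
    rw [hgD]
    calc exp (-(s * setDistEdges A X)) ≤ exp (-s * linkSetDist A w) := exp_le_exp.2 (by rw [heq]; nlinarith)
      _ ≤ ∑ e ∈ X, exp (-s * linkSetDist A e) := single_le_sum (f := fun e => exp (-s * linkSetDist A e)) (fun e _ => (exp_pos _).le) hw
  have hexp1 : ∀ A X : Finset (ZdEdge d), exp (-(s * setDistEdges A X)) ≤ 1 :=
    fun A X => exp_le_one_iff.2 (by nlinarith [setDistEdges_nonneg A X])
  -- centred observables
  obtain ⟨F₁, hF₁⟩ : ∃ f : LGConfig d (Matrix.specialUnitaryGroup (Fin N) ℂ) → ℝ, f = fun σ => F σ - F 1 := ⟨_, rfl⟩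
  obtain ⟨V₁, hV₁⟩ : ∃ f : Finset (ZdEdge d) → LGConfig d (Matrix.specialUnitaryGroup (Fin N) ℂ) → ℝ, f = fun X σ => V X σ - V X 1 :=
    ⟨_, rfl⟩
  obtain ⟨V₁', hV₁'⟩ : ∃ f : Finset (ZdEdge d) → LGConfig d (Matrix.specialUnitaryGroup (Fin N) ℂ) → ℝ, f = fun X σ => V' X σ - V' X 1 :=
    ⟨_, rfl⟩
  have hN2 : (0 : ℝ) ≤ 2 * Real.sqrt N := by positivity
  have hcentre : ∀ {h : LGConfig d (Matrix.specialUnitaryGroup (Fin N) ℂ) → ℝ} {Δ : Finset (ZdEdge d)} {δ : ZdEdge d → ℝ},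
      DependsOn h (↑Δ : Set (ZdEdge d)) → IsLipBound suFrobDist h δ →
      (DependsOn (fun σ => h σ - h 1) (↑Δ : Set (ZdEdge d))) ∧ IsLipBound suFrobDist (fun σ => h σ - h 1) δ ∧
        ∀ σ, |h σ - h 1| ≤ 2 * Real.sqrt N * ∑ y ∈ Δ, δ y := by
    intro h Δ δ hdep hδ
    refine ⟨fun σ τ hστ => by simp only [hdep hστ], ⟨hδ.nonneg, fun y σ τ hστ => by
      simpa only [sub_sub_sub_cancel_right] using hδ.le y σ τ hστ⟩, fun σ => ?_⟩
    calc |h σ - h 1| ≤ ∑ y ∈ Δ, δ y * suFrobDist (σ y) ((1 : LGConfig d (Matrix.specialUnitaryGroup (Fin N) ℂ)) y) :=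
          abs_sub_le_sum_of_dependsOn hdep hδ σ 1
      _ ≤ ∑ y ∈ Δ, δ y * (2 * Real.sqrt N) := sum_le_sum fun y _ => mul_le_mul_of_nonneg_left (suFrobDist_le _ _) (hδ.nonneg y)
      _ = 2 * Real.sqrt N * ∑ y ∈ Δ, δ y := by rw [← sum_mul]; ring
  obtain ⟨hF₁dep, hF₁lip, hF₁b⟩ := hcentre hFdep hδF
  have hF₁m : Measurable F₁ := hF₁ ▸ hFm.sub measurable_const
  -- the per-term tree bound for the centred observables
  have hterm : ∀ X Y, |cov[fun σ => F σ * V X σ, V' Y; μ] - (∫ σ, F σ ∂μ) * cov[V X, V' Y; μ] - (∫ σ, V X σ ∂μ) * cov[F, V' Y; μ]| ≤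
      192 * N * Real.sqrt N * Sf * LX X * LY Y *
        ((exp (-(s * setDistEdges ΛF Y)) + exp (-(s * setDistEdges X Y))) *
          (exp (-(s * setDistEdges ΛF X)) + exp (-(s * setDistEdges Y X))) *
          (exp (-(s * setDistEdges X ΛF)) + exp (-(s * setDistEdges Y ΛF)))) := by
    intro X Y
    obtain ⟨hXdep, hXlip, hXb⟩ := hcentre (hVdep X) (hlipV X)
    obtain ⟨hYdep, hYlip, hYb⟩ := hcentre (hV'dep Y) (hlipV' Y)
    obtain ⟨CX, hCX⟩ := hVb X
    obtain ⟨CY, hCY⟩ := hV'b Y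
    have hXm : Measurable fun σ => V X σ - V X 1 := (hVm X).sub measurable_const
    have hYm : Measurable fun σ => V' Y σ - V' Y 1 := (hV'm Y).sub measurable_const
    -- centring: `u₃(F; V_X; V'_Y) = u₃(F − F(1); V_X − V_X(1); V'_Y − V'_Y(1))` (rotate / centre the last slot, three times)
    have hFcm : Measurable (fun σ => F σ - F 1) := hFm.sub measurable_const
    have hCX' : ∀ σ, |V X σ - V X 1| ≤ CX + CX := fun σ => (abs_sub _ _).trans (add_le_add (hCX σ) (hCX 1))
    have hCY' : ∀ σ, |V' Y σ - V' Y 1| ≤ CY + CY := fun σ => (abs_sub _ _).trans (add_le_add (hCY σ) (hCY 1))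
    have hMF' : ∀ σ, |F σ - F 1| ≤ MF + MF := fun σ => (abs_sub _ _).trans (add_le_add (hMF σ) (hMF 1))
    have e0 : cov[fun σ => F σ * V X σ, V' Y; μ] - (∫ σ, F σ ∂μ) * cov[V X, V' Y; μ] - (∫ σ, V X σ ∂μ) * cov[F, V' Y; μ] =
        cov[fun σ => (F σ - F 1) * (V X σ - V X 1), fun σ => V' Y σ - V' Y 1; μ] -
          (∫ σ, (F σ - F 1) ∂μ) * cov[fun σ => V X σ - V X 1, fun σ => V' Y σ - V' Y 1; μ] -
          (∫ σ, (V X σ - V X 1) ∂μ) * cov[fun σ => F σ - F 1, fun σ => V' Y σ - V' Y 1; μ] :=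
      calc cov[fun σ => F σ * V X σ, V' Y; μ] - (∫ σ, F σ ∂μ) * cov[V X, V' Y; μ] - (∫ σ, V X σ ∂μ) * cov[F, V' Y; μ]
          = cov[fun σ => V X σ * V' Y σ, F; μ] - (∫ σ, V X σ ∂μ) * cov[V' Y, F; μ] - (∫ σ, V' Y σ ∂μ) * cov[V X, F; μ] :=
            threePoint_rotate hFm (hVm X) (hV'm Y) hMF hCX hCY
        _ = cov[fun σ => V X σ * V' Y σ, fun σ => F σ - F 1; μ] - (∫ σ, V X σ ∂μ) * cov[V' Y, fun σ => F σ - F 1; μ] -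
              (∫ σ, V' Y σ ∂μ) * cov[V X, fun σ => F σ - F 1; μ] :=
            (threePoint_sub_const_right (hVm X) (hV'm Y) hFm hCX hCY hMF (F 1)).symm
        _ = cov[fun σ => V' Y σ * (F σ - F 1), V X; μ] - (∫ σ, V' Y σ ∂μ) * cov[fun σ => F σ - F 1, V X; μ] -
              (∫ σ, (F σ - F 1) ∂μ) * cov[V' Y, V X; μ] :=
            threePoint_rotate (hVm X) (hV'm Y) hFcm hCX hCY hMF'
        _ = cov[fun σ => V' Y σ * (F σ - F 1), fun σ => V X σ - V X 1; μ] -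
              (∫ σ, V' Y σ ∂μ) * cov[fun σ => F σ - F 1, fun σ => V X σ - V X 1; μ] -
              (∫ σ, (F σ - F 1) ∂μ) * cov[V' Y, fun σ => V X σ - V X 1; μ] :=
            (threePoint_sub_const_right (hV'm Y) hFcm (hVm X) hCY hMF' hCX (V X 1)).symm
        _ = cov[fun σ => (F σ - F 1) * (V X σ - V X 1), V' Y; μ] - (∫ σ, (F σ - F 1) ∂μ) * cov[fun σ => V X σ - V X 1, V' Y; μ] -
              (∫ σ, (V X σ - V X 1) ∂μ) * cov[fun σ => F σ - F 1, V' Y; μ] :=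
            threePoint_rotate (hV'm Y) hFcm hXm hCY hMF' hCX'
        _ = _ := (threePoint_sub_const_right hFcm hXm (hV'm Y) hMF' hCX' hCY (V' Y 1)).symm
    rw [e0]
    have h1 := abs_threePoint_le_tree_S hd hN hc hv hb hP hVB ht.le hρ hW hμ hFcm hF₁dep hF₁b hF₁lip hXm hXdep hXb
      hXlip hYm hYdep hYb hYlip
    rw [← hSf, show (∑ y ∈ X, lipV X y) = LX X by rw [hLX], show (∑ y ∈ Y, lipV' Y y) = LY Y by rw [hLY]] at h1
    refine h1.trans (le_of_eq ?_)
    have hNsq : Real.sqrt N * Real.sqrt N = N := Real.mul_self_sqrt hNN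
    rw [← hs]
    have : 16 * (N : ℝ) * ((2 * Real.sqrt N * Sf * LX X + 2 * Real.sqrt N * LX X * Sf) * LY Y +
        (2 * Real.sqrt N * Sf * LY Y + 2 * Real.sqrt N * LY Y * Sf) * LX X +
        (2 * Real.sqrt N * LX X * LY Y + 2 * Real.sqrt N * LY Y * LX X) * Sf) = 192 * N * Real.sqrt N * Sf * LX X * LY Y := by ring
    rw [this]
  -- trees: the three-bracket product is at most four trees, each dominated by link sums
  have htree : ∀ X Y, X.Nonempty → Y.Nonempty → ΛF.Nonempty →
      (exp (-(s * setDistEdges ΛF Y)) + exp (-(s * setDistEdges X Y))) *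
          (exp (-(s * setDistEdges ΛF X)) + exp (-(s * setDistEdges Y X))) *
          (exp (-(s * setDistEdges X ΛF)) + exp (-(s * setDistEdges Y ΛF))) ≤
        4 * ((∑ e ∈ X, gD ΛF e) * (∑ e ∈ Y, gD ΛF e) + (∑ e ∈ X, gD ΛF e) * (∑ e ∈ Y, gD X e) +
          (∑ e ∈ Y, gD ΛF e) * (∑ e ∈ X, gD Y e)) := by
    intro X Y hX hY hΛ
    -- symmetric distances
    have hsym : ∀ A B : Finset (ZdEdge d), setDistEdges A B = setDistEdges B A := fun A B => by
      by_cases hA : A.Nonempty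
      · by_cases hB : B.Nonempty
        · apply le_antisymm
          · obtain ⟨u, hu, w, hw, heq⟩ := exists_setDistEdges_eq hB hA
            rw [heq, norm_sub_rev]; exact setDistEdges_le_norm_sub hw hu
          · obtain ⟨u, hu, w, hw, heq⟩ := exists_setDistEdges_eq hA hB
            rw [heq, norm_sub_rev]; exact setDistEdges_le_norm_sub hw hu
        · rw [setDistEdges_of_not_nonempty hB, setDistEdges]; rw [dif_neg]; exact fun ⟨p, hp⟩ => hB ⟨p.1, (Finset.mem_product.1 hp).1⟩
      · rw [setDistEdges_of_not_nonempty hA, setDistEdges]; rw [dif_neg]; exact fun ⟨p, hp⟩ => hA ⟨p.1, (Finset.mem_product.1 hp).1⟩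
    rw [hsym Y X, hsym X ΛF, hsym Y ΛF]
    obtain ⟨p, hp⟩ : ∃ x : ℝ, x = exp (-(s * setDistEdges ΛF X)) := ⟨_, rfl⟩
    obtain ⟨q, hq⟩ : ∃ x : ℝ, x = exp (-(s * setDistEdges ΛF Y)) := ⟨_, rfl⟩
    obtain ⟨r, hr⟩ : ∃ x : ℝ, x = exp (-(s * setDistEdges X Y)) := ⟨_, rfl⟩
    rw [← hp, ← hq, ← hr]
    have hp0 : 0 ≤ p := by rw [hp]; exact (exp_pos _).le
    have hq0 : 0 ≤ q := by rw [hq]; exact (exp_pos _).le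
    have hr0 : 0 ≤ r := by rw [hr]; exact (exp_pos _).le
    have hb := brackets_le_four_trees hp0 (hp ▸ hexp1 ΛF X) hq0 (hq ▸ hexp1 ΛF Y) hr0 (hr ▸ hexp1 X Y)
    have cp : p ≤ ∑ e ∈ X, gD ΛF e := hp ▸ hconv hΛ hX
    have cq : q ≤ ∑ e ∈ Y, gD ΛF e := hq ▸ hconv hΛ hY
    have cr : r ≤ ∑ e ∈ Y, gD X e := hr ▸ hconv hX hY
    have cr' : r ≤ ∑ e ∈ X, gD Y e := by rw [hr, hsym X Y]; exact hconv hY hX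
    have gX0 : 0 ≤ ∑ e ∈ X, gD ΛF e := sum_nonneg fun e _ => hgD0 _ _
    have gY0 : 0 ≤ ∑ e ∈ Y, gD ΛF e := sum_nonneg fun e _ => hgD0 _ _
    calc (q + r) * (p + r) * (p + q) ≤ 4 * (p * q + p * r + q * r) := hb
      _ ≤ 4 * ((∑ e ∈ X, gD ΛF e) * (∑ e ∈ Y, gD ΛF e) + (∑ e ∈ X, gD ΛF e) * (∑ e ∈ Y, gD X e) +
          (∑ e ∈ Y, gD ΛF e) * (∑ e ∈ X, gD Y e)) := by
        gcongr
  -- assemble the termwise bound (empty `Λ_F`, `X` or `Y` contribute `0`)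
  have hRHS0 : 0 ≤ 768 * N * Real.sqrt N * Sf * (LX X * LY Y * ((∑ e ∈ X, gD ΛF e) * (∑ e ∈ Y, gD ΛF e) + (∑ e ∈ X, gD ΛF e) * (∑ e ∈ Y, gD X e) + (∑ e ∈ Y, gD ΛF e) * (∑ e ∈ X, gD Y e))) := by
    have := hLX0 X; have := hLY0 Y
    have : 0 ≤ (∑ e ∈ X, gD ΛF e) := sum_nonneg fun e _ => hgD0 _ _
    have : 0 ≤ (∑ e ∈ Y, gD ΛF e) := sum_nonneg fun e _ => hgD0 _ _
    have : 0 ≤ (∑ e ∈ Y, gD X e) := sum_nonneg fun e _ => hgD0 _ _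
    have : 0 ≤ (∑ e ∈ X, gD Y e) := sum_nonneg fun e _ => hgD0 _ _
    positivity
  refine (hterm X Y).trans ?_
  by_cases hΛF : ΛF.Nonempty
  swap
  · have hS0 : Sf = 0 := by rw [hSf, Finset.not_nonempty_iff_eq_empty.1 hΛF, sum_empty]
    rw [hS0]; simp
  by_cases hX : X.Nonempty
  · by_cases hY : Y.Nonempty
    · have h := htree X Y hX hY hΛF
      have hK : 0 ≤ 192 * N * Real.sqrt N * Sf * LX X * LY Y := by
        have := hLX0 X; have := hLY0 Y; positivity
      calc 192 * N * Real.sqrt N * Sf * LX X * LY Y * _ ≤ 192 * N * Real.sqrt N * Sf * LX X * LY Y * _ := mul_le_mul_of_nonneg_left h hK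
        _ = _ := by ring
    · have hY0 : LY Y = 0 := by rw [hLY]; simp [Finset.not_nonempty_iff_eq_empty.1 hY]
      rw [hY0]; simp
  · have hX0 : LX X = 0 := by rw [hLX]; simp [Finset.not_nonempty_iff_eq_empty.1 hX]
    rw [hX0]; simp

/-- **Partial sums of the majorant (bookkeeping form).**  Directions with Frobenius-Lipschitz witnesses of total loads `≤ L, L'` and size-weighted
loads `≤ L₂, L₂'` through every link; abbreviations as in `abs_threePoint_le_majorant_S` and `C_s = d((1+e^{−s/d})/(1−e^{−s/d}))^d`.  Then for all
finite families `T`, `T'`: `Σ_{X∈T} Σ_{Y∈T'} Φ(X, Y) ≤ 768 N√N S_f (#Λ_F C_s)(L L' #Λ_F C_s + L' L₂ C_s + L L₂' C_s)`. -/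
theorem sum_majorant_le_S (hd : 1 ≤ d) {t : ℝ} (ht : 0 < t) {ΛF : Finset (ZdEdge d)} {δF : ZdEdge d → ℝ} (hδF0 : ∀ y, 0 ≤ δF y)
    {V V' : Potential (ZdEdge d) (Matrix.specialUnitaryGroup (Fin N) ℂ)}
    {lipV : Finset (ZdEdge d) → ZdEdge d → ℝ} (hlipV : ∀ X, IsLipBound suFrobDist (V X) (lipV X)) {L L₂ : ℝ}
    (hLs : ∀ e, Summable fun X : Finset (ZdEdge d) => (if e ∈ X then ∑ y ∈ X, lipV X y else 0))
    (hL : ∀ e, ∑' X : Finset (ZdEdge d), (if e ∈ X then ∑ y ∈ X, lipV X y else 0) ≤ L)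
    (hL2s : ∀ e, Summable fun X : Finset (ZdEdge d) => (if e ∈ X then X.card * ∑ y ∈ X, lipV X y else 0))
    (hL2 : ∀ e, ∑' X : Finset (ZdEdge d), (if e ∈ X then X.card * ∑ y ∈ X, lipV X y else 0) ≤ L₂)
    {lipV' : Finset (ZdEdge d) → ZdEdge d → ℝ} (hlipV' : ∀ X, IsLipBound suFrobDist (V' X) (lipV' X)) {L' L₂' : ℝ}
    (hL's : ∀ e, Summable fun X : Finset (ZdEdge d) => (if e ∈ X then ∑ y ∈ X, lipV' X y else 0))
    (hL' : ∀ e, ∑' X : Finset (ZdEdge d), (if e ∈ X then ∑ y ∈ X, lipV' X y else 0) ≤ L')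
    (hL2's : ∀ e, Summable fun X : Finset (ZdEdge d) => (if e ∈ X then X.card * ∑ y ∈ X, lipV' X y else 0))
    (hL2' : ∀ e, ∑' X : Finset (ZdEdge d), (if e ∈ X then X.card * ∑ y ∈ X, lipV' X y else 0) ≤ L₂')
    {s : ℝ} (hs : s = t / 3) {Sf : ℝ} (hSf : Sf = ∑ y ∈ ΛF, δF y)
    {LX LY : Finset (ZdEdge d) → ℝ} (hLX : LX = fun X => ∑ y ∈ X, lipV X y) (hLY : LY = fun Y => ∑ y ∈ Y, lipV' Y y)
    {gD : Finset (ZdEdge d) → ZdEdge d → ℝ} (hgD : gD = fun Δ e => exp (-s * linkSetDist Δ e))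
    {Cs : ℝ} (hCs : Cs = (d : ℝ) * ((1 + exp (-(s / d))) / (1 - exp (-(s / d)))) ^ d) (T T' : Finset (Finset (ZdEdge d))) :
    ∑ X ∈ T, ∑ Y ∈ T', 768 * N * Real.sqrt N * Sf * (LX X * LY Y * ((∑ e ∈ X, gD ΛF e) * (∑ e ∈ Y, gD ΛF e) +
        (∑ e ∈ X, gD ΛF e) * (∑ e ∈ Y, gD X e) + (∑ e ∈ Y, gD ΛF e) * (∑ e ∈ X, gD Y e))) ≤
      768 * N * Real.sqrt N * Sf * (ΛF.card * Cs) * (L * L' * (ΛF.card * Cs) + L' * L₂ * Cs + L * L₂' * Cs) := by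
  classical
  have hs0 : 0 < s := by rw [hs]; positivity
  have hSf0 : 0 ≤ Sf := hSf ▸ sum_nonneg fun y _ => hδF0 y
  have hLX0 : ∀ X, 0 ≤ LX X := fun X => by rw [hLX]; exact sum_nonneg fun y _ => (hlipV X).nonneg y
  have hLY0 : ∀ Y, 0 ≤ LY Y := fun Y => by rw [hLY]; exact sum_nonneg fun y _ => (hlipV' Y).nonneg y
  have hgD0 : ∀ Δ e, 0 ≤ gD Δ e := fun Δ e => by rw [hgD]; exact (exp_pos _).le
  have hd0 : 0 < d := hd
  have hL0 : 0 ≤ L := le_trans (tsum_nonneg fun X => by split_ifs; exacts [sum_nonneg fun y _ => (hlipV X).nonneg y, le_rfl]) (hL (0, ⟨0, hd0⟩))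
  have hL'0 : 0 ≤ L' :=
    le_trans (tsum_nonneg fun X => by split_ifs; exacts [sum_nonneg fun y _ => (hlipV' X).nonneg y, le_rfl]) (hL' (0, ⟨0, hd0⟩))
  have hL20 : 0 ≤ L₂ := le_trans (tsum_nonneg fun X => by
    split_ifs; exacts [mul_nonneg (Nat.cast_nonneg _) (sum_nonneg fun y _ => (hlipV X).nonneg y), le_rfl]) (hL2 (0, ⟨0, hd0⟩))
  have hL2'0 : 0 ≤ L₂' := le_trans (tsum_nonneg fun X => by
    split_ifs; exacts [mul_nonneg (Nat.cast_nonneg _) (sum_nonneg fun y _ => (hlipV' X).nonneg y), le_rfl]) (hL2' (0, ⟨0, hd0⟩))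
  have hr1 : exp (-(s / d)) < 1 := Real.exp_lt_one_iff.2 (neg_lt_zero.2 (by positivity))
  have hCs0 : 0 ≤ Cs := by
    rw [hCs]; have : 0 ≤ (1 + exp (-(s / d))) / (1 - exp (-(s / d))) := div_nonneg (by positivity) (by linarith)
    positivity
  have hNN : (0 : ℝ) ≤ N := Nat.cast_nonneg N
  -- the profile sums: `Σ' gD Δ ≤ #Δ · Cs` for nonempty `Δ`
  have hprof : ∀ {Δ : Finset (ZdEdge d)}, Δ.Nonempty → Summable (gD Δ) ∧ ∑' e, gD Δ e ≤ Δ.card * Cs := fun hΔ => by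
    have h := summable_exp_neg_linkSetDist hd hs0 hΔ
    rw [← hCs] at h; rw [hgD]; exact h
  -- the load bookkeeping
  have hLs' : ∀ e, Summable fun X : Finset (ZdEdge d) => (if e ∈ X then LX X else 0) := fun e => by rw [hLX]; exact hLs e
  have hL'' : ∀ e, ∑' X : Finset (ZdEdge d), (if e ∈ X then LX X else 0) ≤ L := fun e => by rw [hLX]; exact hL e
  have hLYs : ∀ e, Summable fun Y : Finset (ZdEdge d) => (if e ∈ Y then LY Y else 0) := fun e => by rw [hLY]; exact hL's e
  have hLY' : ∀ e, ∑' Y : Finset (ZdEdge d), (if e ∈ Y then LY Y else 0) ≤ L' := fun e => by rw [hLY]; exact hL' e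
  have hL2Xs : ∀ e, Summable fun X : Finset (ZdEdge d) => (if e ∈ X then X.card * LX X else 0) := fun e => by rw [hLX]; exact hL2s e
  have hL2X : ∀ e, ∑' X : Finset (ZdEdge d), (if e ∈ X then X.card * LX X else 0) ≤ L₂ := fun e => by rw [hLX]; exact hL2 e
  have hL2Ys : ∀ e, Summable fun Y : Finset (ZdEdge d) => (if e ∈ Y then Y.card * LY Y else 0) := fun e => by rw [hLY]; exact hL2's e
  have hL2Y : ∀ e, ∑' Y : Finset (ZdEdge d), (if e ∈ Y then Y.card * LY Y else 0) ≤ L₂' := fun e => by rw [hLY]; exact hL2' e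
  -- inner sums against a fixed set `Δ`: `Σ_{Y∈T'} LY·Σ_{e∈Y} gD Δ e ≤ L'·#Δ·Cs`
  have hinnerY : ∀ {Δ : Finset (ZdEdge d)}, Δ.Nonempty → ∑ Y ∈ T', LY Y * ∑ e ∈ Y, gD Δ e ≤ L' * (Δ.card * Cs) := fun hΔ =>
    (sum_mul_sum_le_of_load (hgD0 _) (hprof hΔ).1 hLY0 hL'0 hLYs hLY').trans (mul_le_mul_of_nonneg_left (hprof hΔ).2 hL'0)
  have hinnerX : ∀ {Δ : Finset (ZdEdge d)}, Δ.Nonempty → ∑ X ∈ T, LX X * ∑ e ∈ X, gD Δ e ≤ L * (Δ.card * Cs) := fun hΔ =>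
    (sum_mul_sum_le_of_load (hgD0 _) (hprof hΔ).1 hLX0 hL0 hLs' hL'').trans (mul_le_mul_of_nonneg_left (hprof hΔ).2 hL0)
  by_cases hΛF : ΛF.Nonempty
  swap
  · have hS0 : Sf = 0 := by rw [hSf, Finset.not_nonempty_iff_eq_empty.1 hΛF, sum_empty]
    rw [hS0]; simp
  have hF' := (hprof hΛF)
  have hS1 : ∑ X ∈ T, ∑ Y ∈ T', LX X * LY Y * ((∑ e ∈ X, gD ΛF e) * ∑ e ∈ Y, gD ΛF e) ≤ L * (ΛF.card * Cs) * (L' * (ΛF.card * Cs)) := by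
    have heq : ∑ X ∈ T, ∑ Y ∈ T', LX X * LY Y * ((∑ e ∈ X, gD ΛF e) * ∑ e ∈ Y, gD ΛF e) =
        (∑ X ∈ T, LX X * ∑ e ∈ X, gD ΛF e) * ∑ Y ∈ T', LY Y * ∑ e ∈ Y, gD ΛF e := by
      rw [sum_mul_sum]; exact sum_congr rfl fun X _ => sum_congr rfl fun Y _ => by ring
    rw [heq]
    exact mul_le_mul (hinnerX hΛF) (hinnerY hΛF) (sum_nonneg fun Y _ => mul_nonneg (hLY0 Y) (sum_nonneg fun e _ => hgD0 _ _))
      (by positivity)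
  have hS2 : ∑ X ∈ T, ∑ Y ∈ T', LX X * LY Y * ((∑ e ∈ X, gD ΛF e) * ∑ e ∈ Y, gD X e) ≤ L₂ * (ΛF.card * Cs) * (L' * Cs) := by
    have h1 : ∀ X ∈ T, ∑ Y ∈ T', LX X * LY Y * ((∑ e ∈ X, gD ΛF e) * ∑ e ∈ Y, gD X e) ≤
        (X.card * LX X * ∑ e ∈ X, gD ΛF e) * (L' * Cs) := by
      intro X _
      by_cases hX : X.Nonempty
      · have heq : ∑ Y ∈ T', LX X * LY Y * ((∑ e ∈ X, gD ΛF e) * ∑ e ∈ Y, gD X e) =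
            (LX X * ∑ e ∈ X, gD ΛF e) * ∑ Y ∈ T', LY Y * ∑ e ∈ Y, gD X e := by
          rw [mul_sum]; exact sum_congr rfl fun Y _ => by ring
        rw [heq]
        have hc1 : (1 : ℝ) ≤ X.card := by exact_mod_cast Finset.Nonempty.card_pos hX
        calc (LX X * ∑ e ∈ X, gD ΛF e) * ∑ Y ∈ T', LY Y * ∑ e ∈ Y, gD X e
            ≤ (LX X * ∑ e ∈ X, gD ΛF e) * (L' * (X.card * Cs)) :=
              mul_le_mul_of_nonneg_left (hinnerY hX) (mul_nonneg (hLX0 X) (sum_nonneg fun e _ => hgD0 _ _))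
          _ = (X.card * LX X * ∑ e ∈ X, gD ΛF e) * (L' * Cs) := by ring
      · have hX0 : LX X = 0 := by rw [hLX]; simp [Finset.not_nonempty_iff_eq_empty.1 hX]
        rw [hX0]; simp
    refine (sum_le_sum h1).trans ?_
    rw [← sum_mul]
    refine mul_le_mul_of_nonneg_right ?_ (by positivity)
    have h2 := sum_mul_sum_le_of_load (T := T) (hgD0 ΛF) hF'.1 (LX := fun X => X.card * LX X)
      (fun X => mul_nonneg (Nat.cast_nonneg _) (hLX0 X)) hL20 hL2Xs hL2X
    exact h2.trans (mul_le_mul_of_nonneg_left hF'.2 hL20)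
  have hS3 : ∑ X ∈ T, ∑ Y ∈ T', LX X * LY Y * ((∑ e ∈ Y, gD ΛF e) * ∑ e ∈ X, gD Y e) ≤ L₂' * (ΛF.card * Cs) * (L * Cs) := by
    rw [Finset.sum_comm]
    have h1 : ∀ Y ∈ T', ∑ X ∈ T, LX X * LY Y * ((∑ e ∈ Y, gD ΛF e) * ∑ e ∈ X, gD Y e) ≤
        (Y.card * LY Y * ∑ e ∈ Y, gD ΛF e) * (L * Cs) := by
      intro Y _
      by_cases hY : Y.Nonempty
      · have heq : ∑ X ∈ T, LX X * LY Y * ((∑ e ∈ Y, gD ΛF e) * ∑ e ∈ X, gD Y e) =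
            (LY Y * ∑ e ∈ Y, gD ΛF e) * ∑ X ∈ T, LX X * ∑ e ∈ X, gD Y e := by
          rw [mul_sum]; exact sum_congr rfl fun X _ => by ring
        rw [heq]
        calc (LY Y * ∑ e ∈ Y, gD ΛF e) * ∑ X ∈ T, LX X * ∑ e ∈ X, gD Y e
            ≤ (LY Y * ∑ e ∈ Y, gD ΛF e) * (L * (Y.card * Cs)) :=
              mul_le_mul_of_nonneg_left (hinnerX hY) (mul_nonneg (hLY0 Y) (sum_nonneg fun e _ => hgD0 _ _))
          _ = (Y.card * LY Y * ∑ e ∈ Y, gD ΛF e) * (L * Cs) := by ring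
      · have hY0 : LY Y = 0 := by rw [hLY]; simp [Finset.not_nonempty_iff_eq_empty.1 hY]
        rw [hY0]; simp
    refine (sum_le_sum h1).trans ?_
    rw [← sum_mul]
    refine mul_le_mul_of_nonneg_right ?_ (by positivity)
    have h2 := sum_mul_sum_le_of_load (T := T') (hgD0 ΛF) hF'.1 (LX := fun Y => Y.card * LY Y)
      (fun Y => mul_nonneg (Nat.cast_nonneg _) (hLY0 Y)) hL2'0 hL2Ys hL2Y
    exact h2.trans (mul_le_mul_of_nonneg_left hF'.2 hL2'0)
  have hK0 : 0 ≤ 768 * N * Real.sqrt N * Sf := by positivity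
  calc ∑ X ∈ T, ∑ Y ∈ T', 768 * N * Real.sqrt N * Sf * (LX X * LY Y * ((∑ e ∈ X, gD ΛF e) * (∑ e ∈ Y, gD ΛF e) + (∑ e ∈ X, gD ΛF e) * (∑ e ∈ Y, gD X e) + (∑ e ∈ Y, gD ΛF e) * (∑ e ∈ X, gD Y e)))
      = ∑ X ∈ T, ∑ Y ∈ T', (768 * N * Real.sqrt N * Sf * (LX X * LY Y * ((∑ e ∈ X, gD ΛF e) * ∑ e ∈ Y, gD ΛF e)) +
          768 * N * Real.sqrt N * Sf * (LX X * LY Y * ((∑ e ∈ X, gD ΛF e) * ∑ e ∈ Y, gD X e)) +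
          768 * N * Real.sqrt N * Sf * (LX X * LY Y * ((∑ e ∈ Y, gD ΛF e) * ∑ e ∈ X, gD Y e))) :=
        sum_congr rfl fun X _ => sum_congr rfl fun Y _ => by ring
    _ = 768 * N * Real.sqrt N * Sf * (∑ X ∈ T, ∑ Y ∈ T', LX X * LY Y * ((∑ e ∈ X, gD ΛF e) * ∑ e ∈ Y, gD ΛF e) +
          ∑ X ∈ T, ∑ Y ∈ T', LX X * LY Y * ((∑ e ∈ X, gD ΛF e) * ∑ e ∈ Y, gD X e) +
          ∑ X ∈ T, ∑ Y ∈ T', LX X * LY Y * ((∑ e ∈ Y, gD ΛF e) * ∑ e ∈ X, gD Y e)) := by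
        simp only [sum_add_distrib, ← Finset.mul_sum]; ring
    _ ≤ 768 * N * Real.sqrt N * Sf * (L * (ΛF.card * Cs) * (L' * (ΛF.card * Cs)) + L₂ * (ΛF.card * Cs) * (L' * Cs) +
          L₂' * (ΛF.card * Cs) * (L * Cs)) := mul_le_mul_of_nonneg_left (add_le_add (add_le_add hS1 hS2) hS3) hK0
    _ = _ := by ring

end SUN

end Summit.Ventures.YMGap.RobustBall

end
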